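import Literature.AnabelianGeometry.EtaleTheta.Discharge.Sec3Cor38iiiTateTowerKummer
import Literature.AnabelianGeometry.EtaleTheta.Discharge.Sec3Cor38OfGaloisCoveringConnected
import Literature.AnabelianGeometry.EtaleTheta.Discharge.Sec3Cor38AllTateTowerR
import Literature.AnabelianGeometry.EtaleTheta.Discharge.Sec3Prop34iiNode
import HarnessLib

/-!
# [EtTh] Corollary 3.8 (i) and (ii) AS TYPED (`Λ = ℤ`) over Def. 3.3 (iii) v2 data `DivisorMonoids.ofTower T` — residual = the Φ-tie and
# `Prop34Const` — and Cor. 3.8 (i) ∧ (ii) ∧ (iii) with NO binder at the v2 MODEL OF RECORD (Kummer–Tate tower)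

S. Mochizuki, *The étale theta function and its Frobenioid-theoretic manifestations*, Publ. RIMS **45** (2009), Cor. 3.8, PDF
pp. 80–81 [cite: MochizukiEtTh2009, Cor 3.8 p.80]; Prop. 3.4 (ii) p.74, Rmk. 3.3.1 p.73, Def. 3.6 (ii) p.77 / Ex. 3.9 (iii) p.84
(«`Φ` := the image of `Φ₀^pf`»).

abc-iut cell, layer L2, seat abc-iut-L2-d2 (gen 5); abc-iut-L2-lead **R625 (d)** «Cor 3.8 (i)(ii) `Λ = ℤ` at RANK-ONE OBJECTS —
re-key of p449948 over `ofRankOneObject`», and the v2 assembly.  PROOF-ONLY; the v2 twin of `Sec3Cor38OfGaloisCoveringConnected`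
(p449574) + `Sec3Cor38OfRankOnePoint` (p449948) + `Sec3Cor38AllOfRankOnePoint` (p451331), over abc-iut-L2-t3's `LogDivisorTower` /
`DivisorMonoids.ofTower` (EVERY connected tempered covering read at the level of its `Δ^fil`-closure):

* §1 inputs for ANY tower `T`: `hP34Λ_ofTower_weak` (Prop. 3.4 (ii) iso₂ per level: abc-iut-w6-d058's `mem_fZero_of_divZeroHom_eq_of`
  through their `ofRlfZWeak_mem_FΛ_of_divΛ_eq_of_iso₂`), `hFinv_ofTower_weak` (`F₀(Y)` a group), (hZQ)
  `isZQMonoprime_primes_Φ₀_ofTower` (abc-iut-w6-d057: primes of `Φ₀(Y)` are `ℤ`-monoprime), `hQ_of_eq_mrange_ofTower` (⟸ Φ-tie;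
  abc-iut-L6-t12's `hQ_ofRlfZWeak_of_ratSupport`);
* §2 `Cor38Hyp.cor38_i_ofTower_of_isFrobenioid_of_eq_mrange` / `cor38_ii_…` — Cor. 3.8 (i), (ii) AS TYPED for tempered Frobenioids with
  print's `Φ` over two towers, ANY category vocabularies; residual {`IsFrobenioid`, Φ-ties, `Prop34Const`} (abc-iut-L1-t12 /
  w6-d039's `cor38_i/ii_weak_of_coord`);
* §3 at RANK-ONE OBJECTS of towers (abc-iut-w5-d179's `ofRankOneObject`; the Φ-tie is `rfl`, `IsFrobenioid` a theorem):
  `TemperedFrobenioid.cor38_i_ii_ofRankOneObject_ofTower (h) (hC hC')` — residual `Prop34Const` only;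
* §4 the v2 MODEL OF RECORD (`TateTowerKummer.temperedFrobenioid`, p465559; `Prop34Const` = `prop34Const_ofTower`, p466252):
  **`TateTowerKummer.cor38_i_ii_temperedFrobenioid (h)`**, **`cor38_temperedFrobenioid (h) : Cor38_i ∧ Cor38_ii ∧ Cor38_iii h`** — NO BINDER
  — the conclusions, the ∃-form, and `hull_selfEquivalence_temperedFrobenioid` (Cor. 3.8 (ii) for every self-equivalence).

HONEST LABEL: instantiation / consistency certificates over the GENUINE weak vocabularies at CONSTRUCTED data (`D` one object at §3–§4);
refereed pre-IUT material; nothing here bears on [IUTchIII] Cor. 3.12; no side taken; typed ≠ proved — here proved modulo the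
displayed binders (§1–§3), with none left at the v2 model of record (§4).
-/

noncomputable section

namespace Literature.AnabelianGeometry.EtaleTheta

open CategoryTheory Opposite Function Literature.AlgebraicGeometry.Frobenioids Literature.AnabelianGeometry.SemiGraphs
  LogDivisorModel LogDivisorModel.GaloisAction LogDivisorTower

universe u u' v'

/-! ## §1 The print-level inputs at `ofRlfZWeak (ofTower T) hpf`, for every tower -/

namespace TemperedFrobenioid

section InputsTower

variable {P : Type u} [Group P] [TopologicalSpace P] {L : LevelSystem P} (T : LogDivisorTower P L)
  (hpf : ∀ Y : (ConnectedPart (BTemp P))ᵒᵖ, IsPerfFactorialCof ((DivisorMonoids.ofTower T).Φ₀.obj Y))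

/-- **`hP34Λ` for EVERY connected tempered covering of a v2 tower** ([EtTh] Prop. 3.4 (ii), iso₂: a function whose `Λ`-divisor is
effective is constant — per level abc-iut-w6-d058's `mem_fZero_of_divZeroHom_eq_of`, through `ofRlfZWeak_mem_FΛ_of_divΛ_eq_of_iso₂`).
[cite: MochizukiEtTh2009, Prop 3.4 (ii) p.74] -/
theorem hP34Λ_ofTower_weak (Y : (ConnectedPart (BTemp P))ᵒᵖ)
    (b : (RealifiedDivisorMonoids.ofRlfZWeak (DivisorMonoids.ofTower T) hpf).BΛ.obj Y)
    (r : (RealifiedDivisorMonoids.ofRlfZWeak (DivisorMonoids.ofTower T) hpf).ΦR.obj Y)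
    (h : (RealifiedDivisorMonoids.ofRlfZWeak (DivisorMonoids.ofTower T) hpf).divΛ Y b = Algebra.GrothendieckGroup.of r) :
    b ∈ (RealifiedDivisorMonoids.ofRlfZWeak (DivisorMonoids.ofTower T) hpf).FΛ Y :=
  RealifiedDivisorMonoids.ofRlfZWeak_mem_FΛ_of_divΛ_eq_of_iso₂ (DivisorMonoids.ofTower T) hpf
    (fun Y' _ x hx => (T.act (L.lvl Y'.unop)).mem_fZero_of_divZeroHom_eq_of (gset Y'.unop) (x := x) hx) Y b r h

/-- **`hFinv` for EVERY connected tempered covering of a v2 tower** (`F₀^ℤ(Y) = Hom_Π(Y, L^×)` is a group).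
[cite: MochizukiEtTh2009, Prop 3.4 (ii) p.74] -/
theorem hFinv_ofTower_weak (Y : (ConnectedPart (BTemp P))ᵒᵖ)
    (b : (RealifiedDivisorMonoids.ofRlfZWeak (DivisorMonoids.ofTower T) hpf).BΛ.obj Y)
    (hb : b ∈ (RealifiedDivisorMonoids.ofRlfZWeak (DivisorMonoids.ofTower T) hpf).FΛ Y) :
    ∃ b' ∈ (RealifiedDivisorMonoids.ofRlfZWeak (DivisorMonoids.ofTower T) hpf).FΛ Y, b' * b = 1 :=
  (RealifiedDivisorMonoids.ofRlfZWeak_hFinv_iff _ hpf).2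
    (fun Y' b' hb' => (T.act (L.lvl Y'.unop)).exists_inv_mem_fZero (gset Y'.unop) b' hb') Y b hb

/-- **(hZQ) for EVERY connected tempered covering of a v2 tower** — Rmk. 3.3.1: the primes of `Φ₀(Y) = Hom_Π(Y, Div⁺(Z_∞^{(lvl Y)}))`
are `ℤ`-monoprime (abc-iut-w6-d057, per level). [cite: MochizukiEtTh2009, Rmk 3.3.1 p.73] -/
theorem isZQMonoprime_primes_Φ₀_ofTower (Y : (ConnectedPart (BTemp P))ᵒᵖ)
    (𝔭 : Primes ((DivisorMonoids.ofTower T).Φ₀.obj Y)) : IsZMonoprime ↥𝔭.submonoid ∨ IsQMonoprime ↥𝔭.submonoid :=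
  Or.inl (isZMonoprime_submonoid_primes_phiZero (T.act (L.lvl Y.unop)) (gset Y.unop) 𝔭)

variable {T hpf} {D : Type u'} [Category.{v'} D] {VD : FrdICatStub.{u', v', u} D}
  (C : TemperedFrobenioid (RealifiedDivisorMonoids.ofRlfZWeak (DivisorMonoids.ofTower T) hpf) D VD)

/-- **(hsat) from the Φ-tie** over a v2 tower: if `Φ(B) = ι(Φ₀(Y_B)^pf)`, every `x ∈ Φ(B)` has a power in the image of `Φ₀(Y_B)`.
[cite: MochizukiEtTh2009, Ex 3.9 p.84] -/
theorem ratSupport_of_eq_mrange_ofTower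
    (hΦ : ∀ B : Dᵒᵖ, C.Φ.carrier B = MonoidHom.mrange (hpf (C.baseOp B)).weak.toRealification) (W : D) :
    ∀ x ∈ C.Φ.carrier (op W),
      ∃ (N : ℕ+) (d : (DivisorMonoids.ofTower T).Φ₀.obj (C.baseOp (op W))),
        x ^ (N : ℕ) = (hpf (C.baseOp (op W))).weak.toRealification (Perfection.of _ d) := by
  intro x hx
  rw [hΦ] at hx
  obtain ⟨a, rfl⟩ := hx
  obtain ⟨⟨c, n⟩, rfl⟩ := Perfection.mk_surjective a
  refine ⟨n, c, ?_⟩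
  change (hpf _).weak.toRealification (Perfection.mk c n) ^ (n : ℕ) = (hpf _).weak.toRealification (Perfection.of _ c)
  rw [← map_pow, Perfection.mk_pow_self]

/-- **`hQ` is a THEOREM for every tempered Frobenioid with print's `Φ` over a v2 tower**: every localized perfection `Φ(W)^pf_𝔮`
is `ℚ`-monoprime (abc-iut-L6-t12's `hQ_ofRlfZWeak_of_ratSupport` with (hZQ), (hsat)). [cite: MochizukiEtTh2009, Def 3.6 p.77] -/
theorem hQ_of_eq_mrange_ofTower (C₀ : TemperedFrobenioid (RealifiedDivisorMonoids.ofRlfZWeak (DivisorMonoids.ofTower T) hpf) D VD)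
    (hΦ : ∀ B : Dᵒᵖ, C₀.Φ.carrier B = MonoidHom.mrange (hpf (C₀.baseOp B)).weak.toRealification) (W : D)
    (𝔮 : Primes (Perfection (C₀.divisorMonoid.obj (op W)))) : IsQMonoprime (PfAt (C₀.divisorMonoid.obj (op W)) 𝔮) :=
  C₀.hQ_ofRlfZWeak_of_ratSupport W (fun 𝔭 => isZQMonoprime_primes_Φ₀_ofTower T _ 𝔭) (C₀.ratSupport_of_eq_mrange_ofTower hΦ W) 𝔮

/-- **[EtTh] Cor. 3.8 (ii) for EVERY self-equivalence** of such a `C`, modulo `hF`, the Φ-tie and `Prop34Const` (abc-iut-L1-t12's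
`hull_selfEquivalence_weak_of_coord`). [cite: MochizukiEtTh2009, Cor 3.8 p.81] -/
theorem hull_selfEquivalence_ofTower_of_eq_mrange (hD : IsOfFSMFFType D)
    (hnd : ∀ (B : Dᵒᵖ) (f : B ⟶ B), treeMonoidVocabWeak.{u}.IsNonDilating (C.Φ.carrier B) (C.Φ.pull f))
    (hds : ∀ (B : D) (α : Aut (Over.forget B)),
      (∀ (B' : Over B) (x : C.divisorMonoid.obj (op B'.left)),
        Literature.AlgebraicGeometry.Frobenioids.pull C.divisorMonoid (α.hom.app B') x = x) → α = 1)
    (hF : PreFrobenioid.IsFrobenioid C.toElem)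
    (hΦ : ∀ B : Dᵒᵖ, C.Φ.carrier B = MonoidHom.mrange (hpf (C.baseOp B)).weak.toRealification)
    (hC : (DivisorMonoids.ofTower T).Prop34Const) (e : C.category ≌ C.category) :
    (∀ {X Y : C.category} (f : X ⟶ Y), C.IsBaseFieldTheoretic f ↔ C.IsBaseFieldTheoretic (e.functor.map f)) ∧
      ∃ e' : C.hullCategory ≌ C.hullCategory, Nonempty (C.hull ⋙ e.functor ≅ e'.functor ⋙ C.hull) :=
  C.hull_selfEquivalence_weak_of_coord hD hnd hds hF (hP34Λ_ofTower_weak T hpf)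
    (C.exists_cnstFn_effective_ofRlfZWeak_of_prop34Const hC) (C.hQ_of_eq_mrange_ofTower hΦ) (hFinv_ofTower_weak T hpf) e

end InputsTower

end TemperedFrobenioid

/-! ## §2 Cor. 3.8 (i), (ii) over two towers, any category vocabularies -/

namespace Cor38Hyp

section Tower

variable {P : Type u} [Group P] [TopologicalSpace P] {L : LevelSystem P} {T : LogDivisorTower P L}
  {hpf : ∀ Y : (ConnectedPart (BTemp P))ᵒᵖ, IsPerfFactorialCof ((DivisorMonoids.ofTower T).Φ₀.obj Y)}
  {P' : Type u} [Group P'] [TopologicalSpace P'] {L' : LevelSystem P'} {T' : LogDivisorTower P' L'}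
  {hpf' : ∀ Y : (ConnectedPart (BTemp P'))ᵒᵖ, IsPerfFactorialCof ((DivisorMonoids.ofTower T').Φ₀.obj Y)}
  {D : Type u'} [Category.{v'} D] {VD : FrdICatStub.{u', v', u} D}
  {D' : Type u'} [Category.{v'} D'] {VD' : FrdICatStub.{u', v', u} D'}
  {C₁ : TemperedFrobenioid (RealifiedDivisorMonoids.ofRlfZWeak (DivisorMonoids.ofTower T) hpf) D VD}
  {C₂ : TemperedFrobenioid (RealifiedDivisorMonoids.ofRlfZWeak (DivisorMonoids.ofTower T') hpf') D' VD'}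

/-- **[EtTh] Cor. 3.8 (i) AS TYPED for tempered Frobenioids with print's `Φ` over two v2 towers**, residual {`hF_i`, Φ-ties,
`Prop34Const_i`}. [cite: MochizukiEtTh2009, Cor 3.8 p.80] -/
theorem cor38_i_ofTower_of_isFrobenioid_of_eq_mrange (h : Cor38Hyp C₁ C₂)
    (hF₁ : PreFrobenioid.IsFrobenioid C₁.toElem) (hF₂ : PreFrobenioid.IsFrobenioid C₂.toElem)
    (hΦ₁ : ∀ B : Dᵒᵖ, C₁.Φ.carrier B = MonoidHom.mrange (hpf (C₁.baseOp B)).weak.toRealification)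
    (hΦ₂ : ∀ B : D'ᵒᵖ, C₂.Φ.carrier B = MonoidHom.mrange (hpf' (C₂.baseOp B)).weak.toRealification)
    (hC₁ : (DivisorMonoids.ofTower T).Prop34Const) (hC₂ : (DivisorMonoids.ofTower T').Prop34Const) :
    Literature.AnabelianGeometry.EtaleTheta.Cor38_i (fun E _ => Literature.AlgebraicGeometry.Frobenioids.IsFrobeniusSlim E) h :=
  h.cor38_i_weak_of_coord hF₁ hF₂ (TemperedFrobenioid.hP34Λ_ofTower_weak T hpf)
    (C₁.exists_cnstFn_effective_ofRlfZWeak_of_prop34Const hC₁) (C₁.hQ_of_eq_mrange_ofTower hΦ₁)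
    (TemperedFrobenioid.hP34Λ_ofTower_weak T' hpf') (C₂.exists_cnstFn_effective_ofRlfZWeak_of_prop34Const hC₂)
    (C₂.hQ_of_eq_mrange_ofTower hΦ₂)

/-- **[EtTh] Cor. 3.8 (ii) AS TYPED for tempered Frobenioids with print's `Φ` over two v2 towers** (same residual).
[cite: MochizukiEtTh2009, Cor 3.8 p.81] -/
theorem cor38_ii_ofTower_of_isFrobenioid_of_eq_mrange (h : Cor38Hyp C₁ C₂)
    (hF₁ : PreFrobenioid.IsFrobenioid C₁.toElem) (hF₂ : PreFrobenioid.IsFrobenioid C₂.toElem)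
    (hΦ₁ : ∀ B : Dᵒᵖ, C₁.Φ.carrier B = MonoidHom.mrange (hpf (C₁.baseOp B)).weak.toRealification)
    (hΦ₂ : ∀ B : D'ᵒᵖ, C₂.Φ.carrier B = MonoidHom.mrange (hpf' (C₂.baseOp B)).weak.toRealification)
    (hC₁ : (DivisorMonoids.ofTower T).Prop34Const) (hC₂ : (DivisorMonoids.ofTower T').Prop34Const) :
    Literature.AnabelianGeometry.EtaleTheta.Cor38_ii
      (fun E _ Φ => ∀ (B : E) (α : Aut (Over.forget B)),
        (∀ (B' : Over B) (x : Φ.obj (op B'.left)),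
          Literature.AlgebraicGeometry.Frobenioids.pull Φ (α.hom.app B') x = x) → α = 1) h :=
  h.cor38_ii_weak_of_coord hF₁ hF₂ (TemperedFrobenioid.hP34Λ_ofTower_weak T hpf)
    (C₁.exists_cnstFn_effective_ofRlfZWeak_of_prop34Const hC₁) (C₁.hQ_of_eq_mrange_ofTower hΦ₁)
    (TemperedFrobenioid.hFinv_ofTower_weak T hpf) (TemperedFrobenioid.hP34Λ_ofTower_weak T' hpf')
    (C₂.exists_cnstFn_effective_ofRlfZWeak_of_prop34Const hC₂) (C₂.hQ_of_eq_mrange_ofTower hΦ₂)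
    (TemperedFrobenioid.hFinv_ofTower_weak T' hpf')

end Tower

end Cor38Hyp

/-! ## §3 Rank-one OBJECTS of towers: residual `Prop34Const` only -/

namespace TemperedFrobenioid

section RankOneObjectTower

-- rank-one objects (`RankOneObject`) are typed for monoids in `Type`: groups `P`, `P'` in `Type` from here on
variable {P : Type} [Group P] [TopologicalSpace P] {L : LevelSystem P} {T : LogDivisorTower P L}
  (Q : (DivisorMonoids.ofTower T).RankOneObject)
  (hpf : ∀ Y : (ConnectedPart (BTemp P))ᵒᵖ, IsPerfFactorialCof ((DivisorMonoids.ofTower T).Φ₀.obj Y))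
  (R S : ((Discrete PUnit.{1})ᵒᵖ ⥤ CommMonCat.{0}) → Prop)
  {P' : Type} [Group P'] [TopologicalSpace P'] {L' : LevelSystem P'} {T' : LogDivisorTower P' L'}
  (Q' : (DivisorMonoids.ofTower T').RankOneObject)
  (hpf' : ∀ Y : (ConnectedPart (BTemp P'))ᵒᵖ, IsPerfFactorialCof ((DivisorMonoids.ofTower T').Φ₀.obj Y))
  (R' S' : ((Discrete PUnit.{1})ᵒᵖ ⥤ CommMonCat.{0}) → Prop)

/-- **The Φ-tie at a rank-one object is definitional**: `Φ(B) = ι(Φ₀(Y₀)^pf)` (print's `Φ`, Ex. 3.9 (iii)). [cite: MochizukiEtTh2009, Def 3.6 p.77] -/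
theorem ofRankOneObject_Φ_eq_mrange (B : (Discrete PUnit.{1})ᵒᵖ) :
    (ofRankOneObject Q hpf R S).Φ.carrier B = MonoidHom.mrange (hpf ((ofRankOneObject Q hpf R S).baseOp B)).weak.toRealification :=
  rfl

/-- **[EtTh] Cor. 3.8 (i) ∧ (ii) AS TYPED between two rank-one-object Frobenioids over v2 towers**, residual = `Prop34Const` of the two
data (the Φ-ties are `rfl`, «`C` is a Frobenioid» is abc-iut-w5-d179's `isFrobenioid_ofRankOneObject`).
[cite: MochizukiEtTh2009, Cor 3.8 p.80] -/
theorem cor38_i_ii_ofRankOneObject_ofTower (h : Cor38Hyp (ofRankOneObject Q hpf R S) (ofRankOneObject Q' hpf' R' S'))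
    (hC : (DivisorMonoids.ofTower T).Prop34Const) (hC' : (DivisorMonoids.ofTower T').Prop34Const) :
    Literature.AnabelianGeometry.EtaleTheta.Cor38_i (fun E _ => Literature.AlgebraicGeometry.Frobenioids.IsFrobeniusSlim E) h ∧
      Literature.AnabelianGeometry.EtaleTheta.Cor38_ii
        (fun E _ Φ => ∀ (B : E) (α : Aut (Over.forget B)),
          (∀ (B' : Over B) (x : Φ.obj (op B'.left)),
            Literature.AlgebraicGeometry.Frobenioids.pull Φ (α.hom.app B') x = x) → α = 1) h :=
  ⟨h.cor38_i_ofTower_of_isFrobenioid_of_eq_mrange (isFrobenioid_ofRankOneObject Q hpf R S)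
      (isFrobenioid_ofRankOneObject Q' hpf' R' S') (ofRankOneObject_Φ_eq_mrange Q hpf R S)
      (ofRankOneObject_Φ_eq_mrange Q' hpf' R' S') hC hC',
    h.cor38_ii_ofTower_of_isFrobenioid_of_eq_mrange (isFrobenioid_ofRankOneObject Q hpf R S)
      (isFrobenioid_ofRankOneObject Q' hpf' R' S') (ofRankOneObject_Φ_eq_mrange Q hpf R S)
      (ofRankOneObject_Φ_eq_mrange Q' hpf' R' S') hC hC'⟩

/-- **[EtTh] Cor. 3.8 (ii) for EVERY self-equivalence of a rank-one-object Frobenioid over a v2 tower**, residual `Prop34Const`.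
[cite: MochizukiEtTh2009, Cor 3.8 p.81] -/
theorem hull_selfEquivalence_ofRankOneObject_ofTower (hC : (DivisorMonoids.ofTower T).Prop34Const)
    (e : (ofRankOneObject Q hpf R S).category ≌ (ofRankOneObject Q hpf R S).category) :
    (∀ {X Y : (ofRankOneObject Q hpf R S).category} (f : X ⟶ Y),
        (ofRankOneObject Q hpf R S).IsBaseFieldTheoretic f ↔ (ofRankOneObject Q hpf R S).IsBaseFieldTheoretic (e.functor.map f)) ∧
      ∃ e' : (ofRankOneObject Q hpf R S).hullCategory ≌ (ofRankOneObject Q hpf R S).hullCategory,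
        Nonempty ((ofRankOneObject Q hpf R S).hull ⋙ e.functor ≅ e'.functor ⋙ (ofRankOneObject Q hpf R S).hull) :=
  (ofRankOneObject Q hpf R S).hull_selfEquivalence_ofTower_of_eq_mrange PadicFrd.isOfFSMType_discretePUnit.isOfFSMFFType
    (ofRankOneObject_nonDilating Q hpf R S) (Toy.isDivSlim45iv_discretePUnit _) (isFrobenioid_ofRankOneObject Q hpf R S)
    (ofRankOneObject_Φ_eq_mrange Q hpf R S) hC e

end RankOneObjectTower

end TemperedFrobenioid

/-! ## §4 The v2 MODEL OF RECORD: Cor. 3.8 (i) ∧ (ii) ∧ (iii), NO binder -/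

namespace TateTowerKummer

variable (R S R' S' : ((Discrete PUnit.{1})ᵒᵖ ⥤ CommMonCat.{0}) → Prop)

/-- **[EtTh] Cor. 3.8 (i) ∧ (ii) AS TYPED, monoid type `ℤ`, at the v2 MODEL OF RECORD, NO binder beyond `h`** (`Prop34Const` =
`prop34Const_ofTower`). [cite: MochizukiEtTh2009, Cor 3.8 p.80] -/
theorem cor38_i_ii_temperedFrobenioid (h : Cor38Hyp (TateTowerKummer.temperedFrobenioid R S) (TateTowerKummer.temperedFrobenioid R' S')) :
    Literature.AnabelianGeometry.EtaleTheta.Cor38_i (fun E _ => Literature.AlgebraicGeometry.Frobenioids.IsFrobeniusSlim E) h ∧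
      Literature.AnabelianGeometry.EtaleTheta.Cor38_ii
        (fun E _ Φ => ∀ (B : E) (α : Aut (Over.forget B)),
          (∀ (B' : Over B) (x : Φ.obj (op B'.left)),
            Literature.AlgebraicGeometry.Frobenioids.pull Φ (α.hom.app B') x = x) → α = 1) h :=
  TemperedFrobenioid.cor38_i_ii_ofRankOneObject_ofTower rankOneObject hpf R S rankOneObject hpf R' S' h prop34Const_ofTower
    prop34Const_ofTower

/-- **[EtTh] Cor. 3.8 (i) ∧ (ii) ∧ (iii) AS TYPED, monoid type `ℤ`, at the v2 MODEL OF RECORD, for every `h`, NO binder beyond `h`**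
((iii) = `cor38_iii_temperedFrobenioid`, p466252). [cite: MochizukiEtTh2009, Cor 3.8 p.80] -/
theorem cor38_temperedFrobenioid (h : Cor38Hyp (TateTowerKummer.temperedFrobenioid R S) (TateTowerKummer.temperedFrobenioid R' S')) :
    Literature.AnabelianGeometry.EtaleTheta.Cor38_i (fun E _ => Literature.AlgebraicGeometry.Frobenioids.IsFrobeniusSlim E) h ∧
      Literature.AnabelianGeometry.EtaleTheta.Cor38_ii
        (fun E _ Φ => ∀ (B : E) (α : Aut (Over.forget B)),
          (∀ (B' : Over B) (x : Φ.obj (op B'.left)),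
            Literature.AlgebraicGeometry.Frobenioids.pull Φ (α.hom.app B') x = x) → α = 1) h ∧
      Cor38_iii h :=
  ⟨(cor38_i_ii_temperedFrobenioid R S R' S' h).1, (cor38_i_ii_temperedFrobenioid R S R' S' h).2,
    cor38_iii_temperedFrobenioid R S R' S' h⟩

/-- **The CONCLUSIONS of Cor. 3.8 (i), (ii) and the first clause of (iii) at the v2 model of record, for every `h`** (the one-object base
is slim and Div-slim). [cite: MochizukiEtTh2009, Cor 3.8 p.81] -/
theorem cor38_conclusion_temperedFrobenioid (h : Cor38Hyp (TateTowerKummer.temperedFrobenioid R S) (TateTowerKummer.temperedFrobenioid R' S')) :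
    (PreservesBaseFieldTheoretic h ∧
      ∃ Ψbs : (TateTowerKummer.temperedFrobenioid R S).hullCategory ≌ (TateTowerKummer.temperedFrobenioid R' S').hullCategory,
        Nonempty ((TateTowerKummer.temperedFrobenioid R S).hull ⋙ h.Ψ.functor ≅ Ψbs.functor ⋙ (TateTowerKummer.temperedFrobenioid R' S').hull)) ∧
      Cor38_iii h :=
  ⟨(cor38_i_ii_temperedFrobenioid R S R' S' h).2 (Toy.isDivSlim45iv_discretePUnit _) (Toy.isDivSlim45iv_discretePUnit _),
    cor38_iii_temperedFrobenioid R S R' S' h⟩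

/-- **The typed statements of the nodes `EtTh:Cor3.8(i)`, `(ii)`, `(iii)` have a SIMULTANEOUS unconditional kernel instance at the v2
MODEL OF RECORD** (`Ψ := 𝟭`). [cite: MochizukiEtTh2009, Cor 3.8 p.80] -/
theorem exists_cor38Hyp_cor38_temperedFrobenioid :
    ∃ h : Cor38Hyp (TateTowerKummer.temperedFrobenioid R S) (TateTowerKummer.temperedFrobenioid R S),
      Literature.AnabelianGeometry.EtaleTheta.Cor38_i (fun E _ => Literature.AlgebraicGeometry.Frobenioids.IsFrobeniusSlim E) h ∧
        Literature.AnabelianGeometry.EtaleTheta.Cor38_ii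
          (fun E _ Φ => ∀ (B : E) (α : Aut (Over.forget B)),
            (∀ (B' : Over B) (x : Φ.obj (op B'.left)),
              Literature.AlgebraicGeometry.Frobenioids.pull Φ (α.hom.app B') x = x) → α = 1) h ∧
        Cor38_iii h := by
  obtain ⟨h⟩ := TemperedFrobenioid.nonempty_cor38Hyp_ofRankOneObject rankOneObject hpf R S
  exact ⟨h, cor38_temperedFrobenioid R S R S h⟩

/-- **[EtTh] Cor. 3.8 (ii) for every self-equivalence of the v2 model-of-record Frobenioid, NO binder.** [cite: MochizukiEtTh2009, Cor 3.8 p.81] -/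
theorem hull_selfEquivalence_temperedFrobenioid (e : (TateTowerKummer.temperedFrobenioid R S).category ≌ (TateTowerKummer.temperedFrobenioid R S).category) :
    (∀ {X Y : (TateTowerKummer.temperedFrobenioid R S).category} (f : X ⟶ Y),
        (TateTowerKummer.temperedFrobenioid R S).IsBaseFieldTheoretic f ↔ (TateTowerKummer.temperedFrobenioid R S).IsBaseFieldTheoretic (e.functor.map f)) ∧
      ∃ e' : (TateTowerKummer.temperedFrobenioid R S).hullCategory ≌ (TateTowerKummer.temperedFrobenioid R S).hullCategory,
        Nonempty ((TateTowerKummer.temperedFrobenioid R S).hull ⋙ e.functor ≅ e'.functor ⋙ (TateTowerKummer.temperedFrobenioid R S).hull) :=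
  TemperedFrobenioid.hull_selfEquivalence_ofRankOneObject_ofTower rankOneObject hpf R S prop34Const_ofTower e

end TateTowerKummer

end Literature.AnabelianGeometry.EtaleTheta

end
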